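import Summits.BirchSwinnertonDyer.BirchSwinnertonDyer.Theorems.AdditiveBranchIMCGordTwoRankZeroOffCaseOneFieldSupplyR0Aux
import HarnessLib

/-!
# Route `AdditiveBranchIMC` (rung K1), crux `MultLower` (stmt-BirchSwinnertonDyer-19359), line
# `tame_roads_mult` v4, stub `stub_fieldSupplyM`: FIELD 2, step 1 — the auxiliary twist of root number
# `−1` for a partner `V` of ANY reduction type at `p` (the SIGN-AGNOSTIC "two candidates" device)

Cell `bsd-addord`, seat `bsd-line-addord-w2`. THEOREMS ONLY (modularity `exists_isNewformOf` explicit).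

On the (M) cell the partner `V ≅ E^{(p*)}` is MULTIPLICATIVE at `p`, so `p ∣ N_V` and the twisting formula
`w(E) = (−1/p)(N_V/p) w(V)` of the (G-ord) file is not available. Instead of computing `w(V)` we build,
for each sign `σ`, a candidate auxiliary prime `ℓ₀` with `(−1)^{(ℓ₀−1)/2} = σ`, the SAME prescribed symbols
`(ℓ₀*/ℓ)` at the odd primes of `N_E M₀` (in particular at `p` and `q`) and `p*q*ℓ₀* ≡ 1 (mod 8)`, and the
twist `X_σ ≅ V^{(δ₁ℓ₀*)}`; the twisting formula at the discriminant `δ₁ℓ₀*` PRIME TO `N_V` gives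
`w(X_σ) = (−1/|δ₁|ℓ₀)(N_V/|δ₁|ℓ₀) w(V)`, and `(N_V/ℓ₀)` depends only on the prescribed symbols and on
`ℓ₀ mod 8` up to sign (Jacobi reciprocity), so `w(X₊) = −w(X₋)`: ONE of the two candidates has root number
`−1` (`exists_candidateTwist_neg`), with no local root number at `p` ever computed.

References: [IrelandRosen1990] Ch. 5 §2; [SilvermanAEC2009] App. C §16; Murty–Murty 1997 Ch. 6 §1.
-/

set_option linter.dupNamespace false

noncomputable section

open scoped Classical

open WeierstrassCurve NumberField IsDedekindDomain
  Literature.NumberTheory.EllipticCurves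
  Literature.NumberTheory.EllipticCurves.ModularForms
  Literature.NumberTheory.EllipticCurves.Rank1Residual
  Literature.NumberTheory.QuadraticFields
  Summit.BirchSwinnertonDyer.Rank1Residual
  Summit.BirchSwinnertonDyer.Rank1Residual.Additive

namespace Summit.BirchSwinnertonDyer.BirchSwinnertonDyer.Theorems.ThreeFieldRoadSupply

open NumberTheorySymbols ZMod
open Summit.BirchSwinnertonDyer.BirchSwinnertonDyer.Theorems.AdditiveKoly.RamifiedHabitat (pStar_emod_four eq_of_prime_dvd_pStar)

/-! ### §1 Jacobi bookkeeping for the two candidates -/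

/-- `χ₈(a) = χ₈(b)` for odd `a, b` with `a* ≡ b* (mod 8)` (`x* = (−1)^{(x−1)/2} x`): `a ≡ ±b (mod 8)` and
`χ₈` is even. [folklore] -/
theorem χ₈_eq_of_pStar_emod_eight {a b : ℕ} (ha : a % 2 = 1) (hb : b % 2 = 1)
    (h : ((-1 : ℤ) ^ (a / 2) * a) % 8 = ((-1 : ℤ) ^ (b / 2) * b) % 8) :
    χ₈ (a : ZMod 8) = χ₈ (b : ZMod 8) := by
  have key : ∀ x : ℕ, x % 2 = 1 →
      ((((-1 : ℤ) ^ (x / 2) * x) % 8 = 1 ↔ (x % 8 = 1 ∨ x % 8 = 7))) := by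
    intro x hx
    have hsx : ((-1 : ℤ) ^ (x / 2)) = if x % 4 = 1 then 1 else -1 := by
      rw [← χ₄_eq_neg_one_pow hx, χ₄_nat_eq_if_mod_four]; simp [hx]
    rw [hsx]
    split_ifs with h4 <;> omega
  have hiff : (a % 8 = 1 ∨ a % 8 = 7) ↔ (b % 8 = 1 ∨ b % 8 = 7) := by
    rw [← key a ha, ← key b hb, h]
  rw [χ₈_nat_eq_if_mod_eight, χ₈_nat_eq_if_mod_eight]
  simp only [ha, hb, one_ne_zero, if_false]
  by_cases hA : a % 8 = 1 ∨ a % 8 = 7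
  · rw [if_pos hA, if_pos (hiff.mp hA)]
  · rw [if_neg hA, if_neg (fun hB ↦ hA (hiff.mpr hB))]

/-- **`(N/ℓ₀)` is determined by the symbols `(ℓ₀*/ℓ)` at the odd primes `ℓ ∣ N` and by `χ₈(ℓ₀)`**
(Jacobi reciprocity `J(n | ℓ₀) = J(ℓ₀* | n)` for the odd part `n` of `N`, and `J(2 | ℓ₀) = χ₈(ℓ₀)`).
[cite: IrelandRosen1990, Ch. 5 §2 Prop. 5.2.2] -/
theorem jacobiSym_eq_of_prescribed {N : ℕ} (hN : N ≠ 0) {a b : ℕ} (ha : a.Prime) (hb : b.Prime)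
    (ha2 : a ≠ 2) (hb2 : b ≠ 2)
    (h : ∀ ℓ : ℕ, ℓ.Prime → ℓ ∣ N → ℓ ≠ 2 →
      J((-1 : ℤ) ^ (a / 2) * a | ℓ) = J((-1 : ℤ) ^ (b / 2) * b | ℓ))
    (h8 : 2 ∣ N → χ₈ (a : ZMod 8) = χ₈ (b : ZMod 8)) :
    J((N : ℤ) | a) = J((N : ℤ) | b) := by
  have haodd : a % 2 = 1 := Nat.odd_iff.mp (ha.eq_two_or_odd'.resolve_left ha2)
  have hbodd : b % 2 = 1 := Nat.odd_iff.mp (hb.eq_two_or_odd'.resolve_left hb2)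
  obtain ⟨e, n, hn, hNe⟩ := Nat.exists_eq_two_pow_mul_odd hN
  have hn0 : n ≠ 0 := by rintro rfl; simp at hn
  -- `J(n | x) = J(x* | n)` for odd primes `x`
  have key : ∀ x : ℕ, x % 2 = 1 → J((n : ℤ) | x) = J((-1 : ℤ) ^ (x / 2) * x | n) := by
    intro x hx
    rw [jacobiSym.quadratic_reciprocity' hn (Nat.odd_iff.mpr hx), qrSign, ← jacobiSym.mul_left,
      χ₄_eq_neg_one_pow hx]
  have hodd_eq : J((-1 : ℤ) ^ (a / 2) * a | n) = J((-1 : ℤ) ^ (b / 2) * b | n) := by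
    rw [← Nat.prod_primeFactorsList hn0, jacobiSym.list_prod_right
      (fun x hx ↦ (Nat.prime_of_mem_primeFactorsList hx).ne_zero), jacobiSym.list_prod_right
      (fun x hx ↦ (Nat.prime_of_mem_primeFactorsList hx).ne_zero)]
    congr 1
    refine List.map_congr_left fun ℓ hℓ ↦ ?_
    have hℓp := Nat.prime_of_mem_primeFactorsList hℓ
    have hℓn := Nat.dvd_of_mem_primeFactorsList hℓ
    refine h ℓ hℓp (hℓn.trans ⟨2 ^ e, by rw [hNe]; ring⟩) ?_
    rintro rfl
    exact (Nat.not_even_iff_odd.mpr hn) (even_iff_two_dvd.mpr hℓn)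
  have hJ2 : J(2 | a) ^ e = J(2 | b) ^ e := by
    rcases Nat.eq_zero_or_pos e with rfl | he
    · simp
    · have h2N : 2 ∣ N := by rw [hNe]; exact Dvd.dvd.mul_right (dvd_pow_self 2 he.ne') n
      rw [jacobiSym.at_two (Nat.odd_iff.mpr haodd), jacobiSym.at_two (Nat.odd_iff.mpr hbodd), h8 h2N]
  rw [hNe, Nat.cast_mul, Nat.cast_pow, jacobiSym.mul_left, jacobiSym.mul_left, jacobiSym.pow_left,
    jacobiSym.pow_left]
  push_cast
  rw [hJ2, key a haodd, key b hbodd, hodd_eq]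

/-! ### §2 The candidate twists -/

section Candidate

variable (W : WeierstrassCurve ℚ) [W.IsElliptic] [W.IsGloballyMinimal] (p : ℕ) [hp : Fact p.Prime]
  {q : ℕ} [hq : Fact q.Prime] (K : Type) [Field K] [NumberField K]
  (V : WeierstrassCurve ℚ) [V.IsElliptic] [V.IsGloballyMinimal]

omit [W.IsGloballyMinimal] [V.IsGloballyMinimal] in
/-- **A candidate auxiliary twist with prescribed sign class.** Data: `E` (`W`), primes `p ≠ q` (odd),
`q ∤ p*δ₁`-type genus factor `δ₁` of the tame-road field `K` (`d_K = q*δ₁`, `δ₁` square-free, prime to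
`p q`, its primes good for `E`), a partner `V` with every bad prime of `V` bad for `E`, an auxiliary level
`M₀ ≠ 0`, a sign `σ` and a sign `εp` (the symbol to be prescribed at `p`). Output: a prime
`ℓ₀ ∉ {2, p, q}`, `ℓ₀ ∤ N_E M₀ δ₁`, with `(−1)^{(ℓ₀−1)/2} = σ`, `p*q*ℓ₀* ≡ 1 (mod 8)`,
`(ℓ₀*/ℓ) = (p*q*/ℓ)` at the odd primes `ℓ ∉ {p, q}` of `N_E M₀`, `(ℓ₀*/q) = (p*δ₁/q)`, `(ℓ₀*/p) = εp`, and
a globally minimal `X ≅ V^{(T)}`, `T = δ₁ℓ₀* ≡ 1 (mod 4)` square-free and prime to `N_V`, with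
`w(X) = J(−1 | |T|)·J(N_V | |T|)·w(V)`. [cite: SilvermanAEC2009, App. C §16] [cite: AtkinLehner1970, §6] -/
theorem exists_candidateTwist (hmod : exists_isNewformOf) (hp2 : p ≠ 2) (hqp : q ≠ p) (hq2 : q ≠ 2)
    (hK : IsImaginaryQuadratic K) (h2K : ((Ideal.span {(2 : ℤ)}).primesOver (𝓞 K)).ncard = 2)
    (hqd : (q : ℤ) ∣ NumberField.discr K)
    (hsplit : ∀ ℓ : ℕ, ℓ.Prime → ℓ ∣ W.conductorNorm ℤ → ℓ ≠ q →
      ((Ideal.span {(ℓ : ℤ)}).primesOver (𝓞 K)).ncard = 2)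
    {δ : ℤ} (hfac : NumberField.discr K = ((-1 : ℤ) ^ (q / 2) * q) * δ) (hδsq : Squarefree δ)
    (hqδ : ¬ (q : ℤ) ∣ δ) (hpδ : ¬ (p : ℤ) ∣ δ)
    (hδgood : ∀ ℓ : ℕ, ℓ.Prime → (ℓ : ℤ) ∣ δ → ¬ ℓ ∣ W.conductorNorm ℤ)
    (hNVW : ∀ ℓ : ℕ, ℓ.Prime → ℓ ∣ V.conductorNorm ℤ → ℓ ∣ W.conductorNorm ℤ)
    (hpN : p ∣ W.conductorNorm ℤ) (hqN : q ∣ W.conductorNorm ℤ) (M₀ : ℕ) (hM₀ : M₀ ≠ 0)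
    {σ : ℤ} (hσ1 : σ = 1 ∨ σ = -1) {εp : ℤ} (hεp : εp = 1 ∨ εp = -1) :
    ∃ (ℓ₀ : ℕ) (X : WeierstrassCurve ℚ) (_ : X.IsElliptic) (_ : X.IsGloballyMinimal)
      (CX : VariableChange ℚ),
      ℓ₀.Prime ∧ ℓ₀ ≠ 2 ∧ ℓ₀ ≠ p ∧ ℓ₀ ≠ q ∧ ¬ ℓ₀ ∣ W.conductorNorm ℤ * M₀ ∧ ¬ (ℓ₀ : ℤ) ∣ δ ∧
      ((-1 : ℤ) ^ (ℓ₀ / 2)) = σ ∧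
      (((-1 : ℤ) ^ (p / 2) * p) * ((-1 : ℤ) ^ (q / 2) * q) * ((-1 : ℤ) ^ (ℓ₀ / 2) * ℓ₀)) % 8 = 1 ∧
      (∀ ℓ : ℕ, ℓ.Prime → ℓ ∣ W.conductorNorm ℤ * M₀ → ℓ ≠ 2 → ℓ ≠ p → ℓ ≠ q →
        J((-1 : ℤ) ^ (ℓ₀ / 2) * ℓ₀ | ℓ) = J(((-1 : ℤ) ^ (p / 2) * p) * ((-1 : ℤ) ^ (q / 2) * q) | ℓ)) ∧
      J((-1 : ℤ) ^ (ℓ₀ / 2) * ℓ₀ | q) = J(((-1 : ℤ) ^ (p / 2) * p) * δ | q) ∧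
      J((-1 : ℤ) ^ (ℓ₀ / 2) * ℓ₀ | p) = εp ∧
      (δ * ((-1 : ℤ) ^ (ℓ₀ / 2) * ℓ₀)) % 4 = 1 ∧ Squarefree (δ * ((-1 : ℤ) ^ (ℓ₀ / 2) * ℓ₀)) ∧
      CX • X = V.quadraticTwist ((δ * ((-1 : ℤ) ^ (ℓ₀ / 2) * ℓ₀) : ℤ) : ℚ) ∧
      X.rootNumber = J(-1 | (δ * ((-1 : ℤ) ^ (ℓ₀ / 2) * ℓ₀)).natAbs) *
        J((V.conductorNorm ℤ : ℤ) | (δ * ((-1 : ℤ) ^ (ℓ₀ / 2) * ℓ₀)).natAbs) * V.rootNumber := by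
  have hpq : p ≠ q := fun h ↦ hqp h.symm
  set ps : ℤ := (-1 : ℤ) ^ (p / 2) * p with hps
  set qs : ℤ := (-1 : ℤ) ^ (q / 2) * q with hqs
  obtain ⟨hdK8, hdK4, -, hdKsq⟩ := discr_emod_eight_of_two_split K hK h2K
  set dK : ℤ := NumberField.discr K with hdK
  clear_value dK
  have hdK0 : dK ≠ 0 := by rw [hdK]; exact NumberField.discr_ne_zero K
  have hNW0 : W.conductorNorm ℤ ≠ 0 := (W.conductorNorm_pos_holds).ne'
  have hNV0 : V.conductorNorm ℤ ≠ 0 := (V.conductorNorm_pos_holds).ne'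
  have hδ0 : δ ≠ 0 := by rintro rfl; rw [mul_zero] at hfac; exact hdK0 hfac
  have hδ4 : δ % 4 = 1 := by
    have hqs4 : qs % 4 = 1 := pStar_emod_four (p := q) hq2
    have h1 : (qs * δ) % 4 = 1 := by rw [← hfac]; exact hdK4
    have h2 : (qs * δ) % 4 = ((qs % 4) * (δ % 4)) % 4 := Int.mul_emod _ _ _
    rw [hqs4, one_mul, Int.emod_emod_of_dvd _ (dvd_refl (4 : ℤ))] at h2
    omega
  -- the auxiliary prime
  set M : ℕ := W.conductorNorm ℤ * M₀ with hM
  have hM0 : M ≠ 0 := mul_ne_zero hNW0 hM₀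
  set Scrt : Finset ℕ := M.primeFactors.erase 2 with hScrt
  have hScrt_mem : ∀ ℓ, ℓ ∈ Scrt ↔ ℓ.Prime ∧ ℓ ∣ M ∧ ℓ ≠ 2 := fun ℓ ↦ by
    rw [hScrt, Finset.mem_erase, Nat.mem_primeFactors]; tauto
  set η : ℕ → ℤ := fun ℓ ↦ if ℓ = p then εp else if ℓ = q then J(ps * δ | q) else J(ps * qs | ℓ)
    with hη
  have hpsq : ¬ (q : ℤ) ∣ ps * δ := by
    intro h
    rcases Int.Prime.dvd_mul' hq.out h with h | h
    · exact hqp (eq_of_prime_dvd_pStar (p := p) hq.out h)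
    · exact hqδ h
  have hη1 : ∀ ℓ ∈ Scrt, η ℓ = 1 ∨ η ℓ = -1 := by
    intro ℓ hℓ
    obtain ⟨hℓp, -, -⟩ := (hScrt_mem ℓ).mp hℓ
    simp only [hη]
    split_ifs with h1 h2
    · exact hεp
    · subst h2
      rcases jacobiSym.trichotomy (ps * δ) ℓ with h0 | h0 | h0
      · exfalso
        have := jacobiSym_mul_self_eq_one hq.out hpsq
        rw [h0, mul_zero] at this
        exact zero_ne_one this
      · exact Or.inl h0
      · exact Or.inr h0
    · rcases jacobiSym.trichotomy (ps * qs) ℓ with h0 | h0 | h0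
      · exfalso
        have := jacobiSym_mul_self_eq_one hℓp (not_dvd_pStar_mul_pStar (p := p) hℓp hq.out h1 h2)
        rw [h0, mul_zero] at this
        exact zero_ne_one this
      · exact Or.inl h0
      · exact Or.inr h0
  set B : ℕ := M * δ.natAbs with hB
  obtain ⟨ℓ₀, hℓ₀, hBℓ₀, hσℓ₀, h8ℓ₀, hJℓ₀⟩ := exists_prime_star_prescribed hp.out hp2 hq.out hq2 hσ1
    Scrt (fun ℓ hℓ ↦ ⟨((hScrt_mem ℓ).mp hℓ).1, ((hScrt_mem ℓ).mp hℓ).2.2⟩) η hη1 B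
  set ls : ℤ := (-1 : ℤ) ^ (ℓ₀ / 2) * ℓ₀ with hls
  have hδa0 : δ.natAbs ≠ 0 := Int.natAbs_ne_zero.mpr hδ0
  have hℓ₀M : ¬ ℓ₀ ∣ M := fun h ↦ by
    have := Nat.le_of_dvd (Nat.pos_of_ne_zero hM0) h
    have : M ≤ B := Nat.le_mul_of_pos_right M (Nat.pos_of_ne_zero hδa0)
    omega
  have hℓ₀δ : ¬ (ℓ₀ : ℤ) ∣ δ := fun h ↦ by
    have h' : ℓ₀ ∣ δ.natAbs := by simpa using Int.natAbs_dvd_natAbs.mpr h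
    have := Nat.le_of_dvd (Nat.pos_of_ne_zero hδa0) h'
    have : δ.natAbs ≤ B := Nat.le_mul_of_pos_left _ (Nat.pos_of_ne_zero hM0)
    omega
  have hℓ₀NW : ¬ ℓ₀ ∣ W.conductorNorm ℤ := fun h ↦ hℓ₀M (h.mul_right _)
  have hℓ₀p : ℓ₀ ≠ p := fun h ↦ hℓ₀NW (h ▸ hpN)
  have hℓ₀q : ℓ₀ ≠ q := fun h ↦ hℓ₀NW (h ▸ hqN)
  have hℓ₀2 : ℓ₀ ≠ 2 := by
    rintro rfl
    have := h8ℓ₀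
    omega
  have hℓ₀odd : ℓ₀ % 2 = 1 := Nat.odd_iff.mp (hℓ₀.eq_two_or_odd'.resolve_left hℓ₀2)
  have hls4 : ls % 4 = 1 := (haveI := Fact.mk hℓ₀; pStar_emod_four (p := ℓ₀) hℓ₀2)
  -- the twist `T = δ ℓ₀*`
  set T : ℤ := δ * ls with hT
  have hT4 : T % 4 = 1 := by
    rw [hT, Int.mul_emod, hδ4, hls4]; decide
  have hT0 : T ≠ 0 := by rintro h; rw [h] at hT4; norm_num at hT4
  have hTq : (T : ℚ) ≠ 0 := by exact_mod_cast hT0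
  have hTsq : Squarefree T := by
    rw [hT, squarefree_mul_iff]
    refine ⟨?_, hδsq, ?_⟩
    · refine (Int.isCoprime_iff_gcd_eq_one.mpr ?_).isRelPrime
      rw [Int.gcd_eq_natAbs, hls, natAbs_pStar]
      exact Nat.Coprime.symm ((Nat.Prime.coprime_iff_not_dvd hℓ₀).mpr fun h ↦
        hℓ₀δ (Int.natAbs_dvd_natAbs.mp (by simpa using h)))
    · rw [hls]; exact (haveI := Fact.mk hℓ₀; squarefree_pStar (p := ℓ₀))
  have hgcd : Int.gcd T (V.conductorNorm ℤ) = 1 := by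
    rw [Int.gcd_eq_natAbs, Int.natAbs_natCast]
    refine Nat.coprime_of_dvd fun ℓ hℓ hℓT hℓN ↦ ?_
    have hℓT' : (ℓ : ℤ) ∣ T := Int.natAbs_dvd_natAbs.mp (by simpa using hℓT)
    rw [hT] at hℓT'
    rcases Int.Prime.dvd_mul' hℓ hℓT' with h | h
    · exact hδgood ℓ hℓ h (hNVW ℓ hℓ hℓN)
    · have hℓeq : ℓ = ℓ₀ := (haveI := Fact.mk hℓ₀; eq_of_prime_dvd_pStar (p := ℓ₀) hℓ h)
      rw [hℓeq] at hℓN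
      exact hℓ₀NW (hNVW ℓ₀ hℓ₀ hℓN)
  obtain ⟨X, iX, iXm, CX, hCX⟩ := exists_isGloballyMinimal_smul_eq_quadraticTwist V hTq
  haveI := V.isElliptic_quadraticTwist hTq
  have hXroot : X.rootNumber = J(-1 | T.natAbs) * J((V.conductorNorm ℤ : ℤ) | T.natAbs) *
      V.rootNumber := by
    obtain ⟨hrootX, -⟩ := V.rootNumber_quadraticTwist_of_emod_four_eq_one hmod hT4 hTsq hgcd
    rw [← hCX, X.rootNumber_smul_holds CX] at hrootX
    exact hrootX
  refine ⟨ℓ₀, X, iX, iXm, CX, hℓ₀, hℓ₀2, hℓ₀p, hℓ₀q, hℓ₀M, hℓ₀δ, hσℓ₀, h8ℓ₀,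
    fun ℓ hℓ hℓM hℓ2 hℓp hℓq ↦ ?_, ?_, ?_, hT4, hTsq, hCX, hXroot⟩
  · have := hJℓ₀ ℓ ((hScrt_mem ℓ).mpr ⟨hℓ, hℓM, hℓ2⟩)
    simp only [hη, hℓp, hℓq, if_false] at this
    exact this
  · have := hJℓ₀ q ((hScrt_mem q).mpr ⟨hq.out, hqN.mul_right _, hq2⟩)
    simp only [hη, hqp, if_false, if_true] at this
    exact this
  · have := hJℓ₀ p ((hScrt_mem p).mpr ⟨hp.out, hpN.mul_right _, hp2⟩)
    simp only [hη, if_true] at this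
    exact this

omit [W.IsGloballyMinimal] [V.IsGloballyMinimal] in
/-- **One of the two candidates has root number `−1`.** With the data of `exists_candidateTwist`:
a candidate `(ℓ₀, X)` (for SOME sign class) with `w(X) = −1`. The two candidates `X₊, X₋` (signs
`σ = ±1`) have `w(X₊) w(X₋) = −1`: in `w(X_σ) = J(−1 | |δ₁|ℓ₀)·J(N_V | |δ₁|ℓ₀)·w(V)` the factor
`J(N_V | ℓ₀)` is the same for both (`jacobiSym_eq_of_prescribed`: same symbols `(ℓ₀*/ℓ)` at the odd
`ℓ ∣ N_V`, and `ℓ₀ ≡ ±ℓ₀' (mod 8)`), while `J(−1 | ℓ₀) = (−1)^{(ℓ₀−1)/2} = σ`.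
[cite: IrelandRosen1990, Ch. 5 §2] [cite: SilvermanAEC2009, App. C §16] -/
theorem exists_candidateTwist_neg (hmod : exists_isNewformOf) (hp2 : p ≠ 2) (hqp : q ≠ p) (hq2 : q ≠ 2)
    (hK : IsImaginaryQuadratic K) (h2K : ((Ideal.span {(2 : ℤ)}).primesOver (𝓞 K)).ncard = 2)
    (hqd : (q : ℤ) ∣ NumberField.discr K)
    (hsplit : ∀ ℓ : ℕ, ℓ.Prime → ℓ ∣ W.conductorNorm ℤ → ℓ ≠ q →
      ((Ideal.span {(ℓ : ℤ)}).primesOver (𝓞 K)).ncard = 2)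
    {δ : ℤ} (hfac : NumberField.discr K = ((-1 : ℤ) ^ (q / 2) * q) * δ) (hδsq : Squarefree δ)
    (hqδ : ¬ (q : ℤ) ∣ δ) (hpδ : ¬ (p : ℤ) ∣ δ)
    (hδgood : ∀ ℓ : ℕ, ℓ.Prime → (ℓ : ℤ) ∣ δ → ¬ ℓ ∣ W.conductorNorm ℤ)
    (hNVW : ∀ ℓ : ℕ, ℓ.Prime → ℓ ∣ V.conductorNorm ℤ → ℓ ∣ W.conductorNorm ℤ)
    (hpN : p ∣ W.conductorNorm ℤ) (hqN : q ∣ W.conductorNorm ℤ) (M₀ : ℕ) (hM₀ : M₀ ≠ 0)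
    {εp : ℤ} (hεp : εp = 1 ∨ εp = -1) :
    ∃ (ℓ₀ : ℕ) (X : WeierstrassCurve ℚ) (_ : X.IsElliptic) (_ : X.IsGloballyMinimal)
      (CX : VariableChange ℚ),
      ℓ₀.Prime ∧ ℓ₀ ≠ 2 ∧ ℓ₀ ≠ p ∧ ℓ₀ ≠ q ∧ ¬ ℓ₀ ∣ W.conductorNorm ℤ * M₀ ∧ ¬ (ℓ₀ : ℤ) ∣ δ ∧
      (((-1 : ℤ) ^ (p / 2) * p) * ((-1 : ℤ) ^ (q / 2) * q) * ((-1 : ℤ) ^ (ℓ₀ / 2) * ℓ₀)) % 8 = 1 ∧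
      (∀ ℓ : ℕ, ℓ.Prime → ℓ ∣ W.conductorNorm ℤ * M₀ → ℓ ≠ 2 → ℓ ≠ p → ℓ ≠ q →
        J((-1 : ℤ) ^ (ℓ₀ / 2) * ℓ₀ | ℓ) = J(((-1 : ℤ) ^ (p / 2) * p) * ((-1 : ℤ) ^ (q / 2) * q) | ℓ)) ∧
      J((-1 : ℤ) ^ (ℓ₀ / 2) * ℓ₀ | q) = J(((-1 : ℤ) ^ (p / 2) * p) * δ | q) ∧
      J((-1 : ℤ) ^ (ℓ₀ / 2) * ℓ₀ | p) = εp ∧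
      (δ * ((-1 : ℤ) ^ (ℓ₀ / 2) * ℓ₀)) % 4 = 1 ∧ Squarefree (δ * ((-1 : ℤ) ^ (ℓ₀ / 2) * ℓ₀)) ∧
      CX • X = V.quadraticTwist ((δ * ((-1 : ℤ) ^ (ℓ₀ / 2) * ℓ₀) : ℤ) : ℚ) ∧ X.rootNumber = -1 := by
  -- the two candidates
  obtain ⟨a, Xa, iXa, iXam, CXa, ha, ha2, hap, haq, haM, haδ, hσa, h8a, hJa, hJaq, hJap, hTa4, hTasq,
      hCXa, hwa⟩ :=
    exists_candidateTwist W p K V hmod hp2 hqp hq2 hK h2K hqd hsplit hfac hδsq hqδ hpδ hδgood hNVW hpN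
      hqN M₀ hM₀ (σ := 1) (Or.inl rfl) hεp
  rcases Xa.rootNumber_eq_one_or with hwa1 | hwa1
  swap
  · exact ⟨a, Xa, iXa, iXam, CXa, ha, ha2, hap, haq, haM, haδ, h8a, hJa, hJaq, hJap, hTa4, hTasq, hCXa,
      hwa1⟩
  obtain ⟨b, Xb, iXb, iXbm, CXb, hb, hb2, hbp, hbq, hbM, hbδ, hσb, h8b, hJb, hJbq, hJbp, hTb4, hTbsq,
      hCXb, hwb⟩ :=
    exists_candidateTwist W p K V hmod hp2 hqp hq2 hK h2K hqd hsplit hfac hδsq hqδ hpδ hδgood hNVW hpN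
      hqN M₀ hM₀ (σ := -1) (Or.inr rfl) hεp
  refine ⟨b, Xb, iXb, iXbm, CXb, hb, hb2, hbp, hbq, hbM, hbδ, h8b, hJb, hJbq, hJbp, hTb4, hTbsq, hCXb, ?_⟩
  -- compare the two root numbers
  have hNV0 : V.conductorNorm ℤ ≠ 0 := (V.conductorNorm_pos_holds).ne'
  have hδ0 : δ ≠ 0 := by
    rintro rfl; rw [mul_zero] at hfac; exact (NumberField.discr_ne_zero K) hfac
  haveI : NeZero δ.natAbs := ⟨Int.natAbs_ne_zero.mpr hδ0⟩
  haveI : NeZero a := ⟨ha.ne_zero⟩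
  haveI : NeZero b := ⟨hb.ne_zero⟩
  have haodd : a % 2 = 1 := Nat.odd_iff.mp (ha.eq_two_or_odd'.resolve_left ha2)
  have hbodd : b % 2 = 1 := Nat.odd_iff.mp (hb.eq_two_or_odd'.resolve_left hb2)
  -- `J(N_V | a) = J(N_V | b)`
  have hJN : J((V.conductorNorm ℤ : ℤ) | a) = J((V.conductorNorm ℤ : ℤ) | b) := by
    refine jacobiSym_eq_of_prescribed hNV0 ha hb ha2 hb2 (fun ℓ hℓ hℓN hℓ2 ↦ ?_) fun _ ↦ ?_
    · have hℓW : ℓ ∣ W.conductorNorm ℤ := hNVW ℓ hℓ hℓN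
      by_cases hℓp : ℓ = p
      · subst hℓp; rw [hJap, hJbp]
      by_cases hℓq : ℓ = q
      · subst hℓq; rw [hJaq, hJbq]
      rw [hJa ℓ hℓ (hℓW.mul_right _) hℓ2 hℓp hℓq, hJb ℓ hℓ (hℓW.mul_right _) hℓ2 hℓp hℓq]
    · refine χ₈_eq_of_pStar_emod_eight haodd hbodd ?_
      -- from `p*q*a* ≡ 1 ≡ p*q*b* (mod 8)` and `(p*q*)² ≡ 1`
      set m : ℤ := ((-1 : ℤ) ^ (p / 2) * p) * ((-1 : ℤ) ^ (q / 2) * q) with hm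
      have hm2 : m % 2 = 1 := by
        have hps4 := pStar_emod_four (p := p) hp2
        have hqs4 := pStar_emod_four (p := q) hq2
        have : m % 4 = 1 := by rw [hm, Int.mul_emod, hps4, hqs4]; decide
        omega
      have hmm : (m * m) % 8 = 1 := Int.mul_self_emod_eight_of_odd hm2
      have key : ∀ x : ℤ, (m * x) % 8 = 1 → x % 8 = (m % 8) := by
        intro x hx
        have e1 : (m * (m * x)) % 8 = ((m % 8) * ((m * x) % 8)) % 8 := Int.mul_emod _ _ _
        rw [hx, mul_one, Int.emod_emod_of_dvd _ (dvd_refl (8 : ℤ))] at e1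
        have e2 : (m * (m * x)) % 8 = ((m * m) % 8 * (x % 8)) % 8 := by
          rw [← mul_assoc]; exact Int.mul_emod _ _ _
        rw [hmm, one_mul, Int.emod_emod_of_dvd _ (dvd_refl (8 : ℤ))] at e2
        rw [← e2, e1]
      rw [key _ h8a, key _ h8b]
  -- the natural-absolute-value bookkeeping `|δ x*| = |δ| x`
  have habs : ∀ x : ℕ, (δ * ((-1 : ℤ) ^ (x / 2) * x)).natAbs = δ.natAbs * x := fun x ↦ by
    rw [Int.natAbs_mul, natAbs_pStar (p := x)]
  have hJ1a : J(-1 | a) = 1 := by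
    rw [jacobiSym.at_neg_one (Nat.odd_iff.mpr haodd), χ₄_eq_neg_one_pow haodd]; exact hσa
  have hJ1b : J(-1 | b) = -1 := by
    rw [jacobiSym.at_neg_one (Nat.odd_iff.mpr hbodd), χ₄_eq_neg_one_pow hbodd]; exact hσb
  rw [hwa, habs a, jacobiSym.mul_right, jacobiSym.mul_right, hJ1a, hJN] at hwa1
  rw [hwb, habs b, jacobiSym.mul_right, jacobiSym.mul_right, hJ1b]
  linear_combination (-1 : ℤ) * hwa1

end Candidate

end Summit.BirchSwinnertonDyer.BirchSwinnertonDyer.Theorems.ThreeFieldRoadSupply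

end
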